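import Mathlib.Analysis.SpecialFunctions.Pow.Deriv
import Mathlib.Topology.MetricSpace.Bounded
import Literature.Analysis.Complex.ConformalRadius
import HarnessLib

/-!
# The conformal radius after removing a small set at the boundary: LSW's (2.16) (proofs only)

Def-free sequel of `ConformalRadius.lean` (the extremal conformal radius
`Literature.Analysis.Complex.conformalRadius K` about `0` of the component of `0` in `𝔻 ∖ K`).
Lawler–Schramm–Werner, *One-arm exponent for critical 2D percolation*, Electron. J. Probab. **7**
(2002), paper no. 2, use in the proof of their Lemma 2.3 (the Neumann boundary condition of the
hitting function at `θ = 2π`, p. 6) the deterministic estimate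

> (2.16) "if `𝔯(K)` denotes the conformal radius of `𝕌 ∖ K`, then
> `min{-log 𝔯(K), 1} ≤ c₂ (diam K)²`, where `c₂` is some constant"

for compact `K ⊂ Ū` meeting `∂𝕌`, justified (p. 7) by monotonicity of the conformal radius and
its explicit value for the complement of a disc orthogonal to `∂𝕌` ("the normalized conformal map
from `𝕌 ∖ B` to `𝕌` is conjugate to the map `z ↦ √z` by Möbius transformations"). We prove it
with `c₂ = 4`, for every bounded `K ⊆ ℂ` containing a point of the unit circle
(`LawlerSchrammWerner2002_min_neg_log_conformalRadius_le`), from the quantitative form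

* `le_conformalRadius_of_subset_closedBall` — **`K ⊆ B̄(ζ, ε)`, `|ζ| = 1`, `ε > 0` ⟹
  `𝔯(K) ≥ (1 - ε²)/(1 + ε²)`**,

obtained by writing down LSW's extremal map (`exists_isUnivalentInto_closedBall_one`): the
univalent map `φ = F₃ ∘ (-i/ε ·) ∘ F₃ ∘ √· ∘ F₁` of `𝔻` onto the complement in `𝔻` of the closed
disc `{|1 - z| ≤ ε |1 + z|}` orthogonal to `∂𝔻` (the preimage of `{|w| ≥ 1/ε}` under the Cayley
map `w = (1 + z)/(1 - z)`; it contains `B̄(1, ε) ∩ 𝔻`), where `F₁(z) = (p - p̄ z)/(1 - z)`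
(disc → upper half-plane, `0 ↦ p`), `√·` is the principal branch (upper half-plane → open first
quadrant), `F₃(v) = (v - 1)/(v + 1)` (first quadrant → upper half-disc, and right half-plane →
disc), `-i/ε ·` (upper half-disc → right half-disc of radius `1/ε`), with base point `p = v₀²`,
`v₀ = (1 + iε)/(1 - iε)`, so that `φ(0) = 0`. Its image omits `B̄(1, ε)`
(`|1 - F₃(w)| = 2/|w + 1| > 2ε/(1 + ε) ≥ ε` for `|w| < 1/ε`, `ε ≤ 1`) and
`|φ'(0)| = (1 - ε²)/(1 + ε²)` by the chain rule. Rotating (`IsUnivalentInto.rotate`) moves the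
boundary point `1` to any `ζ ∈ ∂𝔻`, and `-log((1 - ε²)/(1 + ε²)) ≤ 3ε²` for `ε ≤ 1/2`
(`neg_log_conformalRadius_le_of_subset_closedBall`).

No harmonic measure is involved here; (2.15) and the conformal-invariance step of LSW's proof of
Lemma 2.3 are not treated. No new definitions, no named facts.

## References

* G. F. Lawler, O. Schramm, W. Werner, *One-arm exponent for critical 2D percolation*, Electron.
  J. Probab. 7 (2002), no. 2, §2, (2.16) and its justification (pp. 6–7)
  [LawlerSchrammWernerEJP2002].
* G. F. Lawler, *Conformally invariant processes in the plane*, AMS (2005), §3.2 [Lawler2008].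

## Mathlib / tree

Mathlib: `Complex.cpow_inv_two_re`, `Complex.cpow_inv_two_im_eq_sqrt`, `Complex.cpow_ofNat_inv_pow`,
`Complex.sq_cpow_two_inv` (`√(v²) = v` for `Re v > 0`), `Complex.hasStrictDerivAt_cpow_const`
(principal square root), Schwarz-lemma based
`conformalRadius` API of the tree (`IsUnivalentInto`, `IsUnivalentInto.norm_deriv_le_conformalRadius`,
`IsUnivalentInto.mono`, `conformalRadius_nonneg`, `conformalRadius_le_one`).
-/

noncomputable section

open Metric Set Filter Topology Complex
open scoped ComplexConjugate Pointwise

namespace Literature.Analysis.Complex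

/-! ### The Cayley-type map `v ↦ (v - 1)/(v + 1)` -/

/-- `v + 1 ≠ 0` if `Re v > 0`. [folklore] -/
theorem add_one_ne_zero_of_re_pos {v : ℂ} (hv : 0 < v.re) : v + 1 ≠ 0 := by
  intro h
  have := congrArg Complex.re h
  simp at this
  linarith

/-- `v + 1 ≠ 0` if `Im v > 0`. [folklore] -/
theorem add_one_ne_zero_of_im_pos {v : ℂ} (hv : 0 < v.im) : v + 1 ≠ 0 := by
  intro h
  have := congrArg Complex.im h
  simp at this
  linarith

/-- The Cayley map `v ↦ (v - 1)/(v + 1)` sends the right half-plane into the unit disc.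
[folklore] -/
theorem norm_cayley_lt_one {v : ℂ} (hv : 0 < v.re) : ‖(v - 1) / (v + 1)‖ < 1 := by
  rw [norm_div, div_lt_one (norm_pos_iff.2 (add_one_ne_zero_of_re_pos hv))]
  have h1 : ‖v - 1‖ ^ 2 < ‖v + 1‖ ^ 2 := by
    rw [← Complex.normSq_eq_norm_sq, ← Complex.normSq_eq_norm_sq]
    simp only [Complex.normSq_apply, sub_re, one_re, add_re, sub_im, one_im, add_im]
    nlinarith
  exact lt_of_pow_lt_pow_left₀ 2 (norm_nonneg _) h1

/-- The Cayley map sends the upper half-plane into the upper half-plane (so the open first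
quadrant into the upper half-disc): `Im ((v - 1)/(v + 1)) = 2 Im v / |v + 1|²`. [folklore] -/
theorem cayley_im_pos {v : ℂ} (hv : 0 < v.im) : 0 < ((v - 1) / (v + 1)).im := by
  have hn : 0 < normSq (v + 1) := Complex.normSq_pos.2 (add_one_ne_zero_of_im_pos hv)
  rw [Complex.div_im]
  simp only [sub_im, one_im, add_re, one_re, sub_re, add_im, sub_zero, add_zero]
  rw [← sub_div]
  apply div_pos _ hn
  nlinarith

/-- The Cayley map is injective away from its pole `-1`. [folklore] -/
theorem cayley_inj {v₁ v₂ : ℂ} (h1 : v₁ + 1 ≠ 0) (h2 : v₂ + 1 ≠ 0)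
    (h : (v₁ - 1) / (v₁ + 1) = (v₂ - 1) / (v₂ + 1)) : v₁ = v₂ := by
  rw [div_eq_div_iff h1 h2] at h
  linear_combination h / 2

/-- The derivative of the Cayley map: `((v - 1)/(v + 1))' = 2/(v + 1)²`. [folklore] -/
theorem hasDerivAt_cayley {v : ℂ} (hv : v + 1 ≠ 0) :
    HasDerivAt (fun v : ℂ ↦ (v - 1) / (v + 1)) (2 / (v + 1) ^ 2) v := by
  have hnum : HasDerivAt (fun v : ℂ ↦ v - 1) 1 v := (hasDerivAt_id v).sub_const 1
  have hden : HasDerivAt (fun v : ℂ ↦ v + 1) 1 v := (hasDerivAt_id v).add_const 1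
  have key : HasDerivAt (fun v : ℂ ↦ (v - 1) / (v + 1))
      ((1 * (v + 1) - (v - 1) * 1) / (v + 1) ^ 2) v := hnum.div hden hv
  exact key.congr_deriv (by ring)

/-- `1 - (v - 1)/(v + 1) = 2/(v + 1)`. [folklore] -/
theorem one_sub_cayley {v : ℂ} (hv : v + 1 ≠ 0) : 1 - (v - 1) / (v + 1) = 2 / (v + 1) := by
  rw [eq_div_iff hv, sub_mul, div_mul_cancel₀ _ hv]
  ring

/-! ### The Möbius map `z ↦ (p - p̄ z)/(1 - z)` of the disc into the upper half-plane -/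

/-- `1 - z ≠ 0` on the unit disc. [folklore] -/
theorem one_sub_ne_zero_of_norm_lt_one {z : ℂ} (hz : ‖z‖ < 1) : (1 : ℂ) - z ≠ 0 := by
  intro h
  have : z = 1 := by linear_combination -h
  rw [this] at hz
  simp at hz

/-- For `Im p > 0`, the Möbius map `z ↦ (p - p̄ z)/(1 - z)` (the inverse of
`u ↦ (u - p)/(u - p̄)`) sends the unit disc into the upper half-plane:
`Im = Im p (1 - |z|²)/|1 - z|²`. [folklore] -/
theorem moebiusUHP_im_pos {p z : ℂ} (hp : 0 < p.im) (hz : ‖z‖ < 1) :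
    0 < ((p - conj p * z) / (1 - z)).im := by
  have hn : 0 < normSq (1 - z) := Complex.normSq_pos.2 (one_sub_ne_zero_of_norm_lt_one hz)
  rw [Complex.div_im, ← sub_div]
  apply div_pos _ hn
  have hz2 : z.re * z.re + z.im * z.im < 1 := by
    have h1 : ‖z‖ ^ 2 < 1 := by nlinarith [norm_nonneg z]
    rwa [← Complex.normSq_eq_norm_sq, Complex.normSq_apply] at h1
  simp only [sub_im, mul_im, conj_re, conj_im, sub_re, one_re, mul_re, one_im]
  nlinarith [mul_pos hp (sub_pos.2 hz2)]

/-- The Möbius map `z ↦ (p - p̄ z)/(1 - z)` is injective away from its pole (`Im p > 0`).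
[folklore] -/
theorem moebiusUHP_inj {p z₁ z₂ : ℂ} (hp : 0 < p.im) (h1 : (1 : ℂ) - z₁ ≠ 0) (h2 : (1 : ℂ) - z₂ ≠ 0)
    (h : (p - conj p * z₁) / (1 - z₁) = (p - conj p * z₂) / (1 - z₂)) : z₁ = z₂ := by
  rw [div_eq_div_iff h1 h2] at h
  have hpp : p - conj p ≠ 0 := by
    intro h0
    have := congrArg Complex.im h0
    simp at this
    linarith
  have : (p - conj p) * (z₁ - z₂) = 0 := by linear_combination h
  rcases mul_eq_zero.1 this with h0 | h0
  · exact absurd h0 hpp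
  · linear_combination h0

/-- The derivative at `0` of `z ↦ (p - p̄ z)/(1 - z)` is `p - p̄ = 2i Im p`. [folklore] -/
theorem hasDerivAt_moebiusUHP_zero (p : ℂ) :
    HasDerivAt (fun z : ℂ ↦ (p - conj p * z) / (1 - z)) (p - conj p) 0 := by
  have hnum : HasDerivAt (fun z : ℂ ↦ p - conj p * z) (-conj p) 0 := by
    simpa using ((hasDerivAt_id (0 : ℂ)).const_mul (conj p)).const_sub p
  have hden : HasDerivAt (fun z : ℂ ↦ 1 - z) (-1) 0 := by
    simpa using (hasDerivAt_id (0 : ℂ)).const_sub 1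
  have key : HasDerivAt (fun z : ℂ ↦ (p - conj p * z) / (1 - z))
      ((-conj p * (1 - 0) - (p - conj p * 0) * (-1)) / (1 - 0) ^ 2) 0 := hnum.div hden (by simp)
  exact key.congr_deriv (by ring)

/-- `z ↦ (p - p̄ z)/(1 - z)` is complex differentiable away from `1`. [folklore] -/
theorem differentiableAt_moebiusUHP {p z : ℂ} (hz : (1 : ℂ) - z ≠ 0) :
    DifferentiableAt ℂ (fun z : ℂ ↦ (p - conj p * z) / (1 - z)) z := by
  apply DifferentiableAt.div
  · fun_prop
  · fun_prop
  · exact hz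

/-! ### The principal square root on the upper half-plane -/

/-- The principal square root of a point of the upper half-plane has positive real part.
[folklore] -/
theorem cpow_half_re_pos {u : ℂ} (hu : 0 < u.im) : 0 < (u ^ (2 : ℂ)⁻¹).re := by
  have hre : |u.re| < ‖u‖ := Complex.abs_re_lt_norm.2 hu.ne'
  rw [Complex.cpow_inv_two_re]
  apply Real.sqrt_pos.2
  have := neg_abs_le u.re
  linarith

/-- The principal square root of a point of the upper half-plane has positive imaginary part
(so it lies in the open first quadrant). [folklore] -/
theorem cpow_half_im_pos {u : ℂ} (hu : 0 < u.im) : 0 < (u ^ (2 : ℂ)⁻¹).im := by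
  have hre : |u.re| < ‖u‖ := Complex.abs_re_lt_norm.2 hu.ne'
  rw [Complex.cpow_inv_two_im_eq_sqrt hu.le]
  apply Real.sqrt_pos.2
  have := le_abs_self u.re
  linarith

/-- The principal square root is injective (its square is the identity). [folklore] -/
theorem cpow_half_injective : Function.Injective fun u : ℂ ↦ u ^ (2 : ℂ)⁻¹ := by
  intro u₁ u₂ h
  have h1 := Complex.cpow_ofNat_inv_pow u₁ 2
  have h2 := Complex.cpow_ofNat_inv_pow u₂ 2
  have h' : u₁ ^ (2 : ℂ)⁻¹ = u₂ ^ (2 : ℂ)⁻¹ := h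
  rw [← h1, ← h2, h']

/-! ### The extremal map for the complement of an orthogonal disc -/

/-- **The explicit extremal map.** For `0 < ε < 1` there is a univalent `φ : 𝔻 → 𝔻 ∖ B̄(1, ε)`
with `φ(0) = 0` and `|φ'(0)| = (1 - ε²)/(1 + ε²)`, namely
`φ = F₃ ∘ (-i/ε ·) ∘ F₃ ∘ √· ∘ F₁` with `F₁(z) = (p - p̄ z)/(1 - z)`, `F₃(v) = (v - 1)/(v + 1)`,
`p = v₀²`, `v₀ = (1 + iε)/(1 - iε)` (the uniformiser of the complement in `𝔻` of the closed disc
orthogonal to `∂𝔻` that corresponds to `{|w| ≥ 1/ε}` under the Cayley map `w = (1 + z)/(1 - z)`;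
LSW p. 7: "conjugate to the map `z ↦ √z` by Möbius transformations").
[cite: LawlerSchrammWernerEJP2002, §2, justification of (2.16) (p. 7)] -/
theorem exists_isUnivalentInto_closedBall_one {ε : ℝ} (h0 : 0 < ε) (h1 : ε < 1) :
    ∃ φ : ℂ → ℂ, IsUnivalentInto (closedBall (1 : ℂ) ε) φ ∧
      ‖deriv φ 0‖ = (1 - ε ^ 2) / (1 + ε ^ 2) := by
  -- the base point `v₀ = (1 + iε)/(1 - iε)` of the quadrant and `p = v₀²` of the half-plane
  set v₀ : ℂ := ⟨(1 - ε ^ 2) / (1 + ε ^ 2), 2 * ε / (1 + ε ^ 2)⟩ with hv₀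
  have hd : 0 < 1 + ε ^ 2 := by positivity
  have hre : 0 < v₀.re := by simp only [hv₀]; apply div_pos _ hd; nlinarith
  have him : 0 < v₀.im := by simp only [hv₀]; positivity
  have hnsq : normSq v₀ = 1 := by
    simp only [hv₀, normSq_mk]
    field_simp
    ring
  have hnorm : ‖v₀‖ = 1 := by
    rw [← Real.sqrt_sq (norm_nonneg v₀), ← Complex.normSq_eq_norm_sq, hnsq, Real.sqrt_one]
  have hv₀0 : v₀ ≠ 0 := fun h ↦ by rw [h] at hre; simp at hre
  have hv₀1 : v₀ + 1 ≠ 0 := add_one_ne_zero_of_re_pos hre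
  have hF3v₀ : (v₀ - 1) / (v₀ + 1) = ε * I := by
    rw [div_eq_iff hv₀1]
    apply Complex.ext
    · simp [hv₀]
      field_simp
      ring
    · simp [hv₀]
      field_simp
      ring
  have hv1 : ‖v₀ + 1‖ ^ 2 = 4 / (1 + ε ^ 2) := by
    rw [← Complex.normSq_eq_norm_sq]
    simp only [hv₀, normSq_apply, add_re, one_re, add_im, one_im]
    field_simp
    ring
  set p : ℂ := v₀ ^ 2 with hp
  have hpim : p.im = 2 * v₀.re * v₀.im := by rw [hp, sq, mul_im]; ring
  have hpim0 : 0 < p.im := by rw [hpim]; positivity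
  have hp0 : p ≠ 0 := pow_ne_zero 2 hv₀0
  have hsqrt : p ^ (2 : ℂ)⁻¹ = v₀ := Complex.sq_cpow_two_inv hre
  -- the scaling constant `c = -i/ε`
  have hεC : (ε : ℂ) ≠ 0 := by exact_mod_cast h0.ne'
  set c : ℂ := -I / ε with hc
  have hc_re : ∀ v : ℂ, (c * v).re = v.im / ε := by
    intro v
    have : c * v = -(I * v) / ε := by rw [hc]; ring
    rw [this, Complex.div_ofReal_re]
    simp
  have hc_norm : ‖c‖ = ε⁻¹ := by
    rw [hc, norm_div, norm_neg, Complex.norm_I, Complex.norm_real, Real.norm_eq_abs,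
      abs_of_pos h0, one_div]
  have hcI : c * (ε * I) = 1 := by
    have : c * (ε * I) = -(I * I) * (ε / ε) := by rw [hc]; ring
    rw [this, I_mul_I, div_self hεC]
    ring
  -- the maps
  set F₁ : ℂ → ℂ := fun z ↦ (p - conj p * z) / (1 - z) with hF₁
  set F₂ : ℂ → ℂ := fun u ↦ u ^ (2 : ℂ)⁻¹ with hF₂
  set F₃ : ℂ → ℂ := fun v ↦ (v - 1) / (v + 1) with hF₃
  set φ : ℂ → ℂ := fun z ↦ F₃ (c * F₃ (F₂ (F₁ z))) with hφ
  -- where the intermediate points live, for `z ∈ 𝔻`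
  have stage : ∀ z : ℂ, ‖z‖ < 1 →
      0 < (F₁ z).im ∧ 0 < (F₂ (F₁ z)).re ∧ 0 < (F₂ (F₁ z)).im ∧
      ‖F₃ (F₂ (F₁ z))‖ < 1 ∧ 0 < (F₃ (F₂ (F₁ z))).im ∧
      0 < (c * F₃ (F₂ (F₁ z))).re ∧ ‖c * F₃ (F₂ (F₁ z))‖ < ε⁻¹ := by
    intro z hz
    have hu : 0 < (F₁ z).im := moebiusUHP_im_pos hpim0 hz
    have hv1 : 0 < (F₂ (F₁ z)).re := cpow_half_re_pos hu
    have hv2 : 0 < (F₂ (F₁ z)).im := cpow_half_im_pos hu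
    have hw1 : ‖F₃ (F₂ (F₁ z))‖ < 1 := norm_cayley_lt_one hv1
    have hw2 : 0 < (F₃ (F₂ (F₁ z))).im := cayley_im_pos hv2
    refine ⟨hu, hv1, hv2, hw1, hw2, ?_, ?_⟩
    · rw [hc_re]; positivity
    · rw [norm_mul, hc_norm]
      calc ε⁻¹ * ‖F₃ (F₂ (F₁ z))‖ < ε⁻¹ * 1 := mul_lt_mul_of_pos_left hw1 (inv_pos.2 h0)
        _ = ε⁻¹ := mul_one _
  -- the image omits `B̄(1, ε)`: `|1 - F₃ w| = 2/|w + 1| > 2ε/(1 + ε) ≥ ε`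
  have omits : ∀ z : ℂ, ‖z‖ < 1 → ε < ‖φ z - 1‖ := by
    intro z hz
    obtain ⟨-, -, -, -, -, hw, hwn⟩ := stage z hz
    set w := c * F₃ (F₂ (F₁ z)) with hw_def
    have hw1 : w + 1 ≠ 0 := add_one_ne_zero_of_re_pos hw
    have hφz : φ z = (w - 1) / (w + 1) := rfl
    rw [hφz, norm_sub_rev, one_sub_cayley hw1, norm_div, RCLike.norm_ofNat,
      lt_div_iff₀ (norm_pos_iff.2 hw1)]
    have hwn' : ‖w + 1‖ < ε⁻¹ + 1 := (norm_add_le _ _).trans_lt (by simpa using hwn)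
    have hε1 : ε * (ε⁻¹ + 1) = 1 + ε := by field_simp
    nlinarith [mul_lt_mul_of_pos_left hwn' h0]
  refine ⟨φ, ⟨?_, ?_, ?_, ?_⟩, ?_⟩
  · -- holomorphic on `𝔻`
    intro z hz
    rw [mem_ball_zero_iff] at hz
    obtain ⟨hu, hv1, -, -, -, hw, -⟩ := stage z hz
    have d1 : DifferentiableAt ℂ F₁ z := differentiableAt_moebiusUHP (one_sub_ne_zero_of_norm_lt_one hz)
    have d2 : DifferentiableAt ℂ (fun z ↦ F₂ (F₁ z)) z :=
      d1.cpow_const (Or.inr hu.ne')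
    have dF3 : DifferentiableAt ℂ F₃ (F₂ (F₁ z)) :=
      (hasDerivAt_cayley (add_one_ne_zero_of_re_pos hv1)).differentiableAt
    have d3 : DifferentiableAt ℂ (fun z ↦ F₃ (F₂ (F₁ z))) z := by
      simpa [Function.comp_def] using dF3.comp z d2
    have d4 : DifferentiableAt ℂ (fun z ↦ c * F₃ (F₂ (F₁ z))) z := d3.const_mul c
    have dF3' : DifferentiableAt ℂ F₃ (c * F₃ (F₂ (F₁ z))) :=
      (hasDerivAt_cayley (add_one_ne_zero_of_re_pos hw)).differentiableAt
    have d5 : DifferentiableAt ℂ (fun z ↦ F₃ (c * F₃ (F₂ (F₁ z)))) z := by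
      simpa [Function.comp_def] using dF3'.comp z d4
    exact d5.differentiableWithinAt
  · -- injective on `𝔻`
    intro z₁ hz₁ z₂ hz₂ heq
    rw [mem_ball_zero_iff] at hz₁ hz₂
    obtain ⟨hu₁, hv₁, -, -, -, hw₁, -⟩ := stage z₁ hz₁
    obtain ⟨hu₂, hv₂, -, -, -, hw₂, -⟩ := stage z₂ hz₂
    have e4 : c * F₃ (F₂ (F₁ z₁)) = c * F₃ (F₂ (F₁ z₂)) :=
      cayley_inj (add_one_ne_zero_of_re_pos hw₁) (add_one_ne_zero_of_re_pos hw₂) heq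
    have hc0 : c ≠ 0 := by
      rw [hc]; exact div_ne_zero (neg_ne_zero.2 I_ne_zero) hεC
    have e3 : F₃ (F₂ (F₁ z₁)) = F₃ (F₂ (F₁ z₂)) := mul_left_cancel₀ hc0 e4
    have e2 : F₂ (F₁ z₁) = F₂ (F₁ z₂) :=
      cayley_inj (add_one_ne_zero_of_re_pos hv₁) (add_one_ne_zero_of_re_pos hv₂) e3
    have e1 : F₁ z₁ = F₁ z₂ := cpow_half_injective e2
    exact moebiusUHP_inj hpim0 (one_sub_ne_zero_of_norm_lt_one hz₁)
      (one_sub_ne_zero_of_norm_lt_one hz₂) e1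
  · -- `φ 0 = 0`
    have hF10 : F₁ 0 = p := by simp [hF₁]
    show F₃ (c * F₃ (F₂ (F₁ 0))) = 0
    rw [hF10]
    show ( c * ((p ^ (2 : ℂ)⁻¹ - 1) / (p ^ (2 : ℂ)⁻¹ + 1)) - 1) / (c * ((p ^ (2 : ℂ)⁻¹ - 1) / (p ^ (2 : ℂ)⁻¹ + 1)) + 1) = 0
    rw [hsqrt, hF3v₀, hcI]
    simp
  · -- `φ(𝔻) ⊆ 𝔻 ∖ B̄(1, ε)`
    intro z hz
    rw [mem_ball_zero_iff] at hz
    obtain ⟨-, -, -, -, -, hw, -⟩ := stage z hz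
    refine ⟨?_, ?_⟩
    · rw [mem_ball_zero_iff]
      exact norm_cayley_lt_one hw
    · rw [mem_closedBall, dist_eq_norm, not_le]
      exact omits z hz
  · -- `|φ'(0)| = (1 - ε²)/(1 + ε²)`
    have hF10 : F₁ 0 = p := by simp [hF₁]
    have e1 : HasDerivAt F₁ (p - conj p) 0 := hasDerivAt_moebiusUHP_zero p
    have e2 : HasDerivAt F₂ ((2 : ℂ)⁻¹ * p ^ ((2 : ℂ)⁻¹ - 1)) p :=
      (Complex.hasStrictDerivAt_cpow_const (Or.inr hpim0.ne')).hasDerivAt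
    have e12 : HasDerivAt (fun z ↦ F₂ (F₁ z)) ((2 : ℂ)⁻¹ * p ^ ((2 : ℂ)⁻¹ - 1) * (p - conj p)) 0 :=
      e2.comp_of_eq 0 e1 hF10.symm
    have hF210 : F₂ (F₁ 0) = v₀ := by rw [hF10]; exact hsqrt
    have e3 : HasDerivAt F₃ (2 / (v₀ + 1) ^ 2) v₀ := hasDerivAt_cayley hv₀1
    have e123 : HasDerivAt (fun z ↦ F₃ (F₂ (F₁ z)))
        (2 / (v₀ + 1) ^ 2 * ((2 : ℂ)⁻¹ * p ^ ((2 : ℂ)⁻¹ - 1) * (p - conj p))) 0 :=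
      e3.comp_of_eq 0 e12 hF210.symm
    have e1234 : HasDerivAt (fun z ↦ c * F₃ (F₂ (F₁ z)))
        (c * (2 / (v₀ + 1) ^ 2 * ((2 : ℂ)⁻¹ * p ^ ((2 : ℂ)⁻¹ - 1) * (p - conj p)))) 0 :=
      e123.const_mul c
    have hF3210 : c * F₃ (F₂ (F₁ 0)) = 1 := by
      rw [hF210]
      show c * ((v₀ - 1) / (v₀ + 1)) = 1
      rw [hF3v₀, hcI]
    have e5 : HasDerivAt F₃ (2 / (1 + 1) ^ 2) 1 := hasDerivAt_cayley (by norm_num)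
    have e : HasDerivAt φ
        (2 / (1 + 1) ^ 2 * (c * (2 / (v₀ + 1) ^ 2 * ((2 : ℂ)⁻¹ * p ^ ((2 : ℂ)⁻¹ - 1) * (p - conj p))))) 0 :=
      e5.comp_of_eq 0 e1234 hF3210.symm
    rw [e.deriv]
    -- the norms of the factors
    have hpow : p ^ ((2 : ℂ)⁻¹ - 1) = v₀⁻¹ := by
      rw [Complex.cpow_sub _ _ hp0, Complex.cpow_one, hsqrt, hp]
      field_simp
    have hsub : p - conj p = (2 * p.im : ℝ) * I := Complex.sub_conj p
    have hn1 : ‖(2 : ℂ) / (1 + 1) ^ 2‖ = 1 / 2 := by norm_num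
    have hn3 : ‖(2 : ℂ) / (v₀ + 1) ^ 2‖ = (1 + ε ^ 2) / 2 := by
      rw [norm_div, norm_pow, hv1, RCLike.norm_ofNat]
      field_simp
      norm_num
    have hn2 : ‖(2 : ℂ)⁻¹ * p ^ ((2 : ℂ)⁻¹ - 1)‖ = 1 / 2 := by
      rw [hpow, norm_mul, norm_inv, norm_inv, hnorm, RCLike.norm_ofNat]
      norm_num
    have hn0 : ‖p - conj p‖ = 2 * p.im := by
      rw [hsub, norm_mul, Complex.norm_I, Complex.norm_real, Real.norm_eq_abs,
        abs_of_pos (by positivity), mul_one]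
    rw [norm_mul, norm_mul, norm_mul, norm_mul, hn1, hc_norm, hn3, hn2, hn0, hpim]
    simp only [hv₀]
    field_simp

/-! ### Rotations -/

/-- **Rotating an admissible map.** If `φ` is admissible for `K` and `|ζ| = 1`, then
`z ↦ ζ φ(ζ⁻¹ z)` is admissible for `ζ • K`. [folklore] -/
theorem IsUnivalentInto.rotate {K : Set ℂ} {φ : ℂ → ℂ} (h : IsUnivalentInto K φ) {ζ : ℂ}
    (hζ : ‖ζ‖ = 1) : IsUnivalentInto (ζ • K) fun z ↦ ζ * φ (ζ⁻¹ * z) := by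
  have hζ0 : ζ ≠ 0 := by rintro rfl; simp at hζ
  have hζi : ‖ζ⁻¹‖ = 1 := by rw [norm_inv, hζ, inv_one]
  have hmaps : MapsTo (fun z : ℂ ↦ ζ⁻¹ * z) (ball 0 1) (ball 0 1) := by
    intro z hz
    rw [mem_ball_zero_iff] at hz ⊢
    rwa [norm_mul, hζi, one_mul]
  refine ⟨?_, ?_, by simp [h.map_zero], fun z hz ↦ ⟨?_, ?_⟩⟩
  · exact (h.differentiableOn.comp (by fun_prop) hmaps).const_mul ζ
  · intro z₁ hz₁ z₂ hz₂ heq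
    have h1 := mul_left_cancel₀ hζ0 heq
    have h2 := h.injOn (hmaps hz₁) (hmaps hz₂) h1
    exact mul_left_cancel₀ (inv_ne_zero hζ0) h2
  · rw [mem_ball_zero_iff, norm_mul, hζ, one_mul, ← mem_ball_zero_iff]
    exact (h.mapsTo (hmaps hz)).1
  · rintro ⟨k, hk, hk'⟩
    have hk'' : φ (ζ⁻¹ * z) = k := by
      have := congrArg (fun w ↦ ζ⁻¹ * w) hk'
      simpa [hζ0] using this.symm
    exact (h.mapsTo (hmaps hz)).2 (hk'' ▸ hk)

/-- The rotated map has the same `|φ'(0)|`. [folklore] -/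
theorem IsUnivalentInto.norm_deriv_rotate {K : Set ℂ} {φ : ℂ → ℂ} (h : IsUnivalentInto K φ)
    {ζ : ℂ} (hζ : ‖ζ‖ = 1) : ‖deriv (fun z ↦ ζ * φ (ζ⁻¹ * z)) 0‖ = ‖deriv φ 0‖ := by
  have hζ0 : ζ ≠ 0 := by rintro rfl; simp at hζ
  have hd : DifferentiableAt ℂ φ 0 :=
    h.differentiableOn.differentiableAt (ball_mem_nhds 0 one_pos)
  have h1 : HasDerivAt (fun z : ℂ ↦ ζ⁻¹ * z) ζ⁻¹ 0 := by
    simpa using (hasDerivAt_id (0 : ℂ)).const_mul ζ⁻¹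
  have h2 : HasDerivAt φ (deriv φ 0) (ζ⁻¹ * 0) := by simpa using hd.hasDerivAt
  have h3 : HasDerivAt (fun z ↦ ζ * φ (ζ⁻¹ * z)) (ζ * (deriv φ 0 * ζ⁻¹)) 0 :=
    (h2.comp 0 h1).const_mul ζ
  rw [h3.deriv, norm_mul, norm_mul, norm_inv, hζ]
  simp

/-! ### LSW's (2.16) -/

/-- **Removing a small set at the boundary costs `O(ε²)` of conformal radius.** If
`K ⊆ B̄(ζ, ε)` with `|ζ| = 1` and `ε > 0`, then `𝔯(K) ≥ (1 - ε²)/(1 + ε²)` (the value for the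
complement of the orthogonal disc, `exists_isUnivalentInto_closedBall_one`, rotated to `ζ`;
trivial for `ε ≥ 1`). [cite: LawlerSchrammWernerEJP2002, §2 (2.16) (pp. 6–7)] -/
theorem le_conformalRadius_of_subset_closedBall {K : Set ℂ} {ζ : ℂ} (hζ : ‖ζ‖ = 1) {ε : ℝ}
    (h0 : 0 < ε) (hK : K ⊆ closedBall ζ ε) :
    (1 - ε ^ 2) / (1 + ε ^ 2) ≤ conformalRadius K := by
  rcases le_or_gt 1 ε with h1 | h1
  · refine le_trans ?_ (conformalRadius_nonneg K)
    exact div_nonpos_of_nonpos_of_nonneg (by nlinarith) (by positivity)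
  obtain ⟨φ, hφ, hderiv⟩ := exists_isUnivalentInto_closedBall_one h0 h1
  have hζ0 : ζ ≠ 0 := by rintro rfl; simp at hζ
  have hrot := hφ.rotate hζ
  have hball : ζ • closedBall (1 : ℂ) ε = closedBall ζ ε := by
    rw [smul_closedBall' hζ0, smul_eq_mul, mul_one, hζ, one_mul]
  rw [hball] at hrot
  have hK' : IsUnivalentInto K fun z ↦ ζ * φ (ζ⁻¹ * z) := hrot.mono hK
  calc (1 - ε ^ 2) / (1 + ε ^ 2) = ‖deriv (fun z ↦ ζ * φ (ζ⁻¹ * z)) 0‖ := by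
        rw [hφ.norm_deriv_rotate hζ, hderiv]
    _ ≤ conformalRadius K := hK'.norm_deriv_le_conformalRadius

/-- **`-log 𝔯(K) ≤ 3ε²`** for `K ⊆ B̄(ζ, ε)`, `|ζ| = 1`, `0 < ε ≤ 1/2`
(`-log((1 - ε²)/(1 + ε²)) = log(1 + ε²) - log(1 - ε²) ≤ ε² + ε²/(1 - ε²)`).
[cite: LawlerSchrammWernerEJP2002, §2 (2.16) (pp. 6–7)] -/
theorem neg_log_conformalRadius_le_of_subset_closedBall {K : Set ℂ} {ζ : ℂ} (hζ : ‖ζ‖ = 1)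
    {ε : ℝ} (h0 : 0 < ε) (h12 : ε ≤ 1 / 2) (hK : K ⊆ closedBall ζ ε) :
    -Real.log (conformalRadius K) ≤ 3 * ε ^ 2 := by
  have hle := le_conformalRadius_of_subset_closedBall hζ h0 hK
  have hε2 : ε ^ 2 ≤ 1 / 4 := by nlinarith
  have hnum : 0 < 1 - ε ^ 2 := by nlinarith
  have hden : 0 < 1 + ε ^ 2 := by positivity
  have hq : 0 < (1 - ε ^ 2) / (1 + ε ^ 2) := div_pos hnum hden
  have hlog : Real.log ((1 - ε ^ 2) / (1 + ε ^ 2)) ≤ Real.log (conformalRadius K) :=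
    Real.log_le_log hq hle
  rw [Real.log_div hnum.ne' hden.ne'] at hlog
  -- `log(1 + ε²) - log(1 - ε²) ≤ 3 ε²`
  have h1 : Real.log (1 + ε ^ 2) ≤ ε ^ 2 := by
    have := Real.log_le_sub_one_of_pos hden
    linarith
  have h2 : -Real.log (1 - ε ^ 2) ≤ 2 * ε ^ 2 := by
    have h3 : Real.log (1 - ε ^ 2)⁻¹ ≤ (1 - ε ^ 2)⁻¹ - 1 :=
      Real.log_le_sub_one_of_pos (inv_pos.2 hnum)
    rw [Real.log_inv] at h3
    have h4 : (1 - ε ^ 2)⁻¹ - 1 ≤ 2 * ε ^ 2 := by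
      rw [inv_eq_one_div, div_sub_one hnum.ne', div_le_iff₀ hnum]
      nlinarith [mul_le_mul_of_nonneg_left hε2 (sq_nonneg ε)]
    linarith
  linarith

/-- **LSW's (2.16)**: for every bounded `K ⊆ ℂ` containing a point of the unit circle,
`min{-log 𝔯(K), 1} ≤ c₂ (diam K)²` with `c₂ = 4` (`K ⊆ B̄(ζ, diam K)` for `ζ ∈ K ∩ ∂𝔻`; the
case `diam K > 1/2` is trivial). LSW state it for connected compact `K ⊂ Ū` meeting `∂𝕌`;
neither connectedness nor `K ⊂ Ū` is needed. [cite: LawlerSchrammWernerEJP2002, §2 (2.16) (p. 6)] -/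
theorem LawlerSchrammWerner2002_min_neg_log_conformalRadius_le {K : Set ℂ}
    (hK : Bornology.IsBounded K) (hζK : ∃ ζ ∈ K, ‖ζ‖ = 1) :
    min (-Real.log (conformalRadius K)) 1 ≤ 4 * diam K ^ 2 := by
  obtain ⟨ζ, hζK, hζ⟩ := hζK
  rcases lt_or_ge (1 / 2) (diam K) with hbig | hsmall
  · exact (min_le_right _ _).trans (by nlinarith)
  rcases (diam_nonneg (s := K)).eq_or_lt with hzero | hpos
  · -- `diam K = 0`: `K = {ζ}`, and `𝔯({ζ}) = 1`
    have hsub : K ⊆ closedBall ζ (1 / 2) := fun x hx ↦ by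
      rw [mem_closedBall]
      have := dist_le_diam_of_mem hK hx hζK
      linarith
    have h := neg_log_conformalRadius_le_of_subset_closedBall hζ (by norm_num) le_rfl hsub
    -- sharpen: `K ⊆ B̄(ζ, δ)` for every `δ > 0`
    have hall : ∀ δ : ℝ, 0 < δ → δ ≤ 1 / 2 → -Real.log (conformalRadius K) ≤ 3 * δ ^ 2 := by
      intro δ hδ hδ2
      refine neg_log_conformalRadius_le_of_subset_closedBall hζ hδ hδ2 fun x hx ↦ ?_
      rw [mem_closedBall]
      have := dist_le_diam_of_mem hK hx hζK
      linarith
    have hle0 : -Real.log (conformalRadius K) ≤ 0 := by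
      refine le_of_forall_pos_lt_add fun η hη ↦ ?_
      obtain ⟨δ, hδ0, hδ⟩ : ∃ δ : ℝ, 0 < δ ∧ δ ≤ 1 / 2 ∧ 3 * δ ^ 2 < η := by
        refine ⟨min (1 / 2) (Real.sqrt (η / 6)), lt_min (by norm_num) (Real.sqrt_pos.2 (by positivity)),
          min_le_left _ _, ?_⟩
        have hs : (min (1 / 2) (Real.sqrt (η / 6))) ^ 2 ≤ η / 6 := by
          have hm : min (1 / 2) (Real.sqrt (η / 6)) ≤ Real.sqrt (η / 6) := min_le_right _ _
          have hm0 : 0 ≤ min (1 / 2) (Real.sqrt (η / 6)) := le_min (by norm_num) (Real.sqrt_nonneg _)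
          calc (min (1 / 2) (Real.sqrt (η / 6))) ^ 2 ≤ (Real.sqrt (η / 6)) ^ 2 :=
                pow_le_pow_left₀ hm0 hm 2
            _ = η / 6 := Real.sq_sqrt (by positivity)
        linarith
      have := hall δ hδ0 hδ.1
      linarith
    calc min (-Real.log (conformalRadius K)) 1 ≤ -Real.log (conformalRadius K) := min_le_left _ _
      _ ≤ 0 := hle0
      _ ≤ 4 * diam K ^ 2 := by positivity
  · have hsub : K ⊆ closedBall ζ (diam K) := fun x hx ↦ by
      rw [mem_closedBall]
      exact dist_le_diam_of_mem hK hx hζK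
    have h := neg_log_conformalRadius_le_of_subset_closedBall hζ hpos hsmall hsub
    calc min (-Real.log (conformalRadius K)) 1 ≤ -Real.log (conformalRadius K) := min_le_left _ _
      _ ≤ 3 * diam K ^ 2 := h
      _ ≤ 4 * diam K ^ 2 := by nlinarith

end Literature.Analysis.Complex
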